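import Literature.Analysis.FluidPDE.KatoPicard
import HarnessLib

/-!
# Kato's Picard iteration in the weighted classes `t^{(1-3/p)/2}L^p ∩ t^{1/2}L^∞`, `3 < p < ∞`

Analysis/FluidPDE proof file (no definitions, no named facts). It proves item (F3) of the
decomposition of `Literature.Analysis.FluidPDE.exists_isBesovMildSolutionOn` (Bahouri–Chemin–
Danchin 2011, Thm. 5.40: local mild solutions for data in `Ḃ^{-1+3/p}_{p,q}`), namely Kato's
fixed point argument (Kato 1984, Thm. 1 and §2: the successive approximations (2.6) in the
weighted norms (2.1)–(2.2) `t^{(1-m/q)/2}‖u(t)‖_q`, here `m = 3`, `q = p ∈ (3, ∞)`, together with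
the weight `t^{1/2}‖u(t)‖_∞`) for the integral equation
`u(t)(x) = U(t)(x) - B(u,u)(t)(x)`,
`B(u, v)(t)(x) = ∫_{(0,t)} ∫ K(t-τ, x-y)[u(τ,y), v(τ,y)] dy dτ`
(`= kochTataruBilinear u v t x`, unit viscosity, `K = oseenKernel`), with an **abstract free
term** `U` subject only to Kato's bounds `‖U(t)‖_{L^p} ≤ α t^{-(1-3/p)/2}`,
`|U(t)(x)| ≤ β t^{-1/2}` on `(0, T)` and `c α ≤ 1`.

The tree's `KatoBilinearEstimates.lean`/`KatoPicard.lean` treat the case `p = 6` with the `L^∞`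
weight read off an `L³` datum; this file runs the same argument for general `3 < p < ∞`:

* `KatoLp.exists_eLpNorm_oseenSlice_le_Lp`, `KatoLp.exists_enorm_oseenSlice_le_Lp` — the slice
  bounds `‖T_σ[a,b]‖_p ≤ C σ^{-1/2-3/(2p)} ‖a‖_p ‖b‖_p` and
  `|T_σ[a,b](x)| ≤ C σ^{-1/2-3/(2p)} ‖a‖_p ‖b‖_∞` (Kato 1984, (2.3)–(2.4');
  `OseenKernelLp.exists_eLpNorm_oseenSlice_le` with `(p/2, p)`, and Hölder with the envelope in
  `L^{p'}`);
* `KatoLp.exists_eLpNorm_oseenDuhamel_le_Lp`, `KatoLp.exists_norm_oseenDuhamel_le_Lp` — Kato's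
  estimates `‖B(u,v)(t)‖_p ≤ c K_u K_v t^{-(1-3/p)/2}`, `|B(u,v)(t)(x)| ≤ c K_u L_v t^{-1/2}`
  (Minkowski in time and the Beta integrals `∫₀ᵗ (t-τ)^{-a}τ^{-b} dτ`);
* `KatoLp.exists_katoLp_step_bounds`, `KatoLp.exists_katoLp_diff_bounds`,
  `KatoLp.exists_katoLp_fixedPoint` — one Picard step, differences of steps, and the pointwise
  limit of the iterates with its Kato bounds and their localisation in time;
* `KatoLp.exists_katoLp_fixedPoint_heatTest` — the specialisation to the free heat evolution
  `U = heatTest 1 v₀` of a strongly measurable datum, in terms of `kochTataruBilinear`.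

## References

* T. Kato, *Strong `L^p`-solutions of the Navier–Stokes equation in `ℝ^m`, with applications to
  weak solutions*, Math. Z. 187 (1984) 471–480, Thm. 1 and §2. [Kato1984]
* P. G. Lemarié-Rieusset, *The Navier–Stokes Problem in the 21st Century*, CRC Press 2016,
  Thm. 7.5 and its proof (PDF pp. 155–158); Thm. 8.7 (PDF p. 191). [LemarieRieusset2016]
* H. Bahouri, J.-Y. Chemin, R. Danchin, *Fourier Analysis and Nonlinear PDE*, Springer 2011,
  Thm. 5.40. [BahouriCheminDanchin2011]
-/

noncomputable section

open MeasureTheory TopologicalSpace Set Function Filter Topology InnerProductSpace Metric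
open scoped RealInnerProductSpace ENNReal NNReal

namespace Literature.Analysis.FluidPDE

namespace KatoLp

variable {E : Type*} [NormedAddCommGroup E] [InnerProductSpace ℝ E] [FiniteDimensional ℝ E]
  [MeasurableSpace E] [BorelSpace E]

/-! ### Unit-viscosity forms of the measurability and bilinearity lemmas -/

section UnitViscosity

/-- Joint measurability of `(τ, x) ↦ ∫ K(t-τ, x-y)[u(τ,y), v(τ,y)] dy` (unit viscosity form of
`stronglyMeasurable_oseenIntegrand`). [folklore] -/
theorem stronglyMeasurable_oseenIntegrand_one {u v : ℝ → E → E} (hum : Measurable (uncurry u))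
    (hvm : Measurable (uncurry v)) (t : ℝ) :
    StronglyMeasurable (uncurry fun (τ : ℝ) (x : E) =>
      ∫ y, oseenKernel (t - τ) (x - y) (u τ y) (v τ y)) := by
  simpa only [one_mul] using stronglyMeasurable_oseenIntegrand hum hvm 1 t

/-- Measurability of the integrand for Minkowski's inequality (unit viscosity form of
`aestronglyMeasurable_oseenIntegrand_swap`). [folklore] -/
theorem aestronglyMeasurable_oseenIntegrand_swap_one {u v : ℝ → E → E}
    (hum : Measurable (uncurry u)) (hvm : Measurable (uncurry v)) (t : ℝ) (μ' : Measure ℝ) :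
    AEStronglyMeasurable (uncurry fun (x : E) (τ : ℝ) =>
      ∫ y, oseenKernel (t - τ) (x - y) (u τ y) (v τ y)) ((volume : Measure E).prod μ') := by
  simpa only [one_mul] using aestronglyMeasurable_oseenIntegrand_swap hum hvm 1 t μ'

/-- Joint measurability of `(t, x) ↦ B(u,v)(t)(x)` (unit viscosity form of
`measurable_uncurry_oseenDuhamel`). [folklore] -/
theorem measurable_uncurry_oseenDuhamel_one {u v : ℝ → E → E} (hum : Measurable (uncurry u))
    (hvm : Measurable (uncurry v)) :
    Measurable (uncurry fun (t : ℝ) (x : E) =>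
      ∫ τ in Ioo 0 t, ∫ y, oseenKernel (t - τ) (x - y) (u τ y) (v τ y)) := by
  simpa only [one_mul] using measurable_uncurry_oseenDuhamel hum hvm 1

/-- Bilinearity in the first slot at a point (unit viscosity form of
`oseenDuhamel_add_left_apply`). [folklore] -/
theorem oseenDuhamel_add_left_apply_one {t : ℝ} {u u' v : ℝ → E → E} {x : E}
    (hi : ∀ τ ∈ Ioo 0 t, Integrable (fun y => oseenKernel (t - τ) (x - y) (u τ y) (v τ y)) volume)
    (hi' : ∀ τ ∈ Ioo 0 t, Integrable (fun y => oseenKernel (t - τ) (x - y) (u' τ y) (v τ y)) volume)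
    (hI : IntegrableOn (fun τ => ∫ y, oseenKernel (t - τ) (x - y) (u τ y) (v τ y)) (Ioo 0 t) volume)
    (hI' : IntegrableOn (fun τ => ∫ y, oseenKernel (t - τ) (x - y) (u' τ y) (v τ y)) (Ioo 0 t) volume) :
    ∫ τ in Ioo 0 t, ∫ y, oseenKernel (t - τ) (x - y) ((u + u') τ y) (v τ y) =
      (∫ τ in Ioo 0 t, ∫ y, oseenKernel (t - τ) (x - y) (u τ y) (v τ y)) +
        ∫ τ in Ioo 0 t, ∫ y, oseenKernel (t - τ) (x - y) (u' τ y) (v τ y) := by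
  rw [← integral_add hI hI']
  refine setIntegral_congr_fun measurableSet_Ioo fun τ hτ => ?_
  simp only [Pi.add_apply]
  rw [← integral_add (hi τ hτ) (hi' τ hτ)]
  exact integral_congr_ae (Eventually.of_forall fun y => oseenKernel_add_left _ _ _ _ _)

/-- Bilinearity in the second slot at a point (unit viscosity form of
`oseenDuhamel_add_right_apply`). [folklore] -/
theorem oseenDuhamel_add_right_apply_one {t : ℝ} {u v v' : ℝ → E → E} {x : E}
    (hi : ∀ τ ∈ Ioo 0 t, Integrable (fun y => oseenKernel (t - τ) (x - y) (u τ y) (v τ y)) volume)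
    (hi' : ∀ τ ∈ Ioo 0 t, Integrable (fun y => oseenKernel (t - τ) (x - y) (u τ y) (v' τ y)) volume)
    (hI : IntegrableOn (fun τ => ∫ y, oseenKernel (t - τ) (x - y) (u τ y) (v τ y)) (Ioo 0 t) volume)
    (hI' : IntegrableOn (fun τ => ∫ y, oseenKernel (t - τ) (x - y) (u τ y) (v' τ y)) (Ioo 0 t) volume) :
    ∫ τ in Ioo 0 t, ∫ y, oseenKernel (t - τ) (x - y) (u τ y) ((v + v') τ y) =
      (∫ τ in Ioo 0 t, ∫ y, oseenKernel (t - τ) (x - y) (u τ y) (v τ y)) +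
        ∫ τ in Ioo 0 t, ∫ y, oseenKernel (t - τ) (x - y) (u τ y) (v' τ y) := by
  rw [← integral_add hI hI']
  refine setIntegral_congr_fun measurableSet_Ioo fun τ hτ => ?_
  simp only [Pi.add_apply]
  rw [← integral_add (hi τ hτ) (hi' τ hτ)]
  exact integral_congr_ae (Eventually.of_forall fun y => oseenKernel_add_right _ _ _ _ _)

end UnitViscosity

/-! ### Exponent bookkeeping -/

section Exponents

/-- `3 < p.toReal` for `3 < p < ∞`. [folklore] -/
theorem three_lt_toReal {p : ℝ≥0∞} (hp₃ : 3 < p) (hp : p < ∞) : 3 < p.toReal := by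
  have h := (ENNReal.toReal_lt_toReal (by norm_num : (3 : ℝ≥0∞) ≠ ∞) hp.ne).2 hp₃
  rwa [ENNReal.toReal_ofNat] at h

/-- The Hölder triple `(p, p, p/2)`: `p⁻¹ + p⁻¹ = (p/2)⁻¹`. [folklore] -/
theorem holderTriple_self_self_half (p : ℝ≥0∞) : ENNReal.HolderTriple p p (p / 2) :=
  ⟨by rw [ENNReal.inv_div (Or.inl ENNReal.ofNat_ne_top) (Or.inl two_ne_zero), div_eq_mul_inv,
    two_mul]⟩

/-- `τ^{-s/2} τ^{-s/2} = τ^{-s}` for `τ > 0`. [folklore] -/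
theorem rpow_neg_half_mul_self {τ : ℝ} (hτ : 0 < τ) (s : ℝ) :
    τ ^ (-(s / 2)) * τ ^ (-(s / 2)) = τ ^ (-s) := by
  rw [← Real.rpow_add hτ]
  congr 1
  ring

/-- `τ^{-s/2} τ^{-1/2} = τ^{-(1 - (1 - s)/2)}` for `τ > 0` (with `s = 1 - 3/p` the right-hand
exponent is `-(1 - 3/(2p))`). [folklore] -/
theorem rpow_neg_half_mul_neg_half {τ : ℝ} (hτ : 0 < τ) (s : ℝ) :
    τ ^ (-(s / 2)) * τ ^ (-(1 / 2 : ℝ)) = τ ^ (-(1 - (1 - s) / 2)) := by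
  rw [← Real.rpow_add hτ]
  congr 1
  ring

end Exponents

/-! ### Slice estimates with `L^p` data -/

section Slice

variable (hE : Module.finrank ℝ E = 3)
include hE

/-- **`L^p` size of a slice** (Kato 1984, (2.3)–(2.4) with `m = 3`, `q = p`): for `3 < p < ∞`
there is `C` with `‖T_σ[a,b]‖_{L^p} ≤ C σ^{-1/2-3/(2p)} ‖a‖_{L^p} ‖b‖_{L^p}` for all `σ > 0`
(`OseenKernelLp.exists_eLpNorm_oseenSlice_le` with the pair `(p/2, p)`:
`-1/2 - (3/2)(2/p - 1/p) = -1/2 - 3/(2p)`, then Hölder `‖|a||b|‖_{p/2} ≤ ‖a‖_p‖b‖_p`). [cite: Kato1984, (2.3)–(2.4)] -/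
theorem exists_eLpNorm_oseenSlice_le_Lp {p : ℝ≥0∞} (hp₃ : 3 < p) (hp : p < ∞) :
    ∃ C : ℝ, 0 ≤ C ∧ ∀ {σ : ℝ}, 0 < σ → ∀ {a b : E → E}, AEStronglyMeasurable a volume →
      AEStronglyMeasurable b volume →
        eLpNorm (fun x => ∫ y, oseenKernel σ (x - y) (a y) (b y)) p volume ≤
          ENNReal.ofReal (C * σ ^ (-(1 / 2 + 3 / (2 * p.toReal)))) *
            (eLpNorm a p volume * eLpNorm b p volume) := by
  haveI := holderTriple_self_self_half p
  have hr3 := three_lt_toReal hp₃ hp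
  have hp2 : 1 < p / 2 := by
    rw [ENNReal.lt_div_iff_mul_lt (Or.inl two_ne_zero) (Or.inl ENNReal.ofNat_ne_top), one_mul]
    exact lt_trans (by norm_num) hp₃
  have hp2top : p / 2 ≠ ∞ := ENNReal.div_ne_top hp.ne two_ne_zero
  obtain ⟨C, hC, h⟩ := exists_eLpNorm_oseenSlice_le (E := E) (p := p / 2) (q := p) hp2 hp2top
    ENNReal.half_le_self
  refine ⟨C, hC, fun {σ} hσ {a b} ha hb => ?_⟩
  have hd : ((Module.finrank ℝ E : ℕ) : ℝ) = 3 := by rw [hE]; norm_num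
  have hexp : -(1 / 2 : ℝ) - (Module.finrank ℝ E : ℝ) / 2 * (1 / (p / 2).toReal - 1 / p.toReal) =
      -(1 / 2 + 3 / (2 * p.toReal)) := by
    rw [hd, ENNReal.toReal_div, ENNReal.toReal_ofNat]
    have hr0 : p.toReal ≠ 0 := by positivity
    field_simp
    ring
  have h' := h hσ ha hb
  rw [hexp] at h'
  exact h'.trans (mul_le_mul' le_rfl (eLpNorm_norm_mul_norm_le ha hb p p (p / 2)))

/-- **Pointwise size of a slice** (Kato 1984, (2.4') with `q = ∞`): for `3 < p < ∞` there is
`C` with `|T_σ[a,b](x)| ≤ C σ^{-1/2-3/(2p)} ‖a‖_{L^p} ‖b‖_{L^∞}` for every `x` and all `σ > 0`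
(Hölder `p'·p` with the `L^{p'}` size of the envelope, `3/(2p') - 2 = -1/2 - 3/(2p)`). [cite: Kato1984, (2.4')] -/
theorem exists_enorm_oseenSlice_le_Lp {p : ℝ≥0∞} (hp₃ : 3 < p) (hp : p < ∞) :
    ∃ C : ℝ, 0 ≤ C ∧ ∀ {σ : ℝ}, 0 < σ → ∀ {a b : E → E}, AEStronglyMeasurable a volume →
      AEStronglyMeasurable b volume → ∀ x : E,
        ‖∫ y, oseenKernel σ (x - y) (a y) (b y)‖ₑ ≤
          ENNReal.ofReal (C * σ ^ (-(1 / 2 + 3 / (2 * p.toReal)))) *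
            (eLpNorm a p volume * eLpNorm b ∞ volume) := by
  have hr3 := three_lt_toReal hp₃ hp
  have hp1' : 1 < p := lt_trans (by norm_num) hp₃
  have hp1 : 1 ≤ p := hp1'.le
  have hp0 : p ≠ 0 := (zero_lt_one.trans hp1').ne'
  obtain ⟨C, hC, hK⟩ := exists_norm_oseenKernel_le (E := E)
  set p' : ℝ≥0∞ := ENNReal.conjExponent p with hp'
  haveI hHC : p.HolderConjugate p' := .conjExponent hp1
  haveI hHC' : p'.HolderConjugate p := inferInstance
  have hp'1 : 1 ≤ p' := ENNReal.HolderConjugate.one_le p' p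
  have hp'top : p' ≠ ∞ := by
    intro h
    have h1 : p⁻¹ + p'⁻¹ = 1 := ENNReal.HolderConjugate.inv_add_inv_eq_one p p'
    rw [h, ENNReal.inv_top, add_zero, ENNReal.inv_eq_one] at h1
    exact absurd h1 hp1'.ne'
  obtain ⟨B, hB0, hB⟩ := exists_eLpNorm_oseenEnvelope_le (E := E) hC.le hp'1 hp'top
  refine ⟨B, hB0, fun {σ} hσ {a b} ha hb x => ?_⟩
  have hd : ((Module.finrank ℝ E : ℕ) : ℝ) = 3 := by rw [hE]; norm_num
  have hinv : 1 / p.toReal + 1 / p'.toReal = 1 := by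
    have h := ENNReal.HolderConjugate.inv_add_inv_eq_one p p'
    have h' := congrArg ENNReal.toReal h
    rw [ENNReal.toReal_add (ENNReal.inv_ne_top.2 hp0)
      (ENNReal.inv_ne_top.2 (ENNReal.HolderConjugate.ne_zero p' p)),
      ENNReal.toReal_inv, ENNReal.toReal_inv, ENNReal.toReal_one] at h'
    simpa only [one_div] using h'
  have hp'r0 : 0 < p'.toReal := ENNReal.toReal_pos (ENNReal.HolderConjugate.ne_zero p' p) hp'top
  have hexp : (Module.finrank ℝ E : ℝ) / (2 * p'.toReal) - ((Module.finrank ℝ E : ℝ) + 1) / 2 =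
      -(1 / 2 + 3 / (2 * p.toReal)) := by
    rw [hd]
    have h1p : 1 / p'.toReal = 1 - 1 / p.toReal := by linarith
    have h2 : (3 : ℝ) / (2 * p'.toReal) = 3 / 2 * (1 / p'.toReal) := by
      field_simp
    rw [h2, h1p]
    ring
  have h1 := enorm_oseenSlice_le_eLpNorm_mul hC.le hK hσ ha hb p' p x
  have h2 := hB σ hσ
  rw [hexp] at h2
  have h3 : eLpNorm (fun y => ‖a y‖ * ‖b y‖) p volume ≤ eLpNorm a p volume * eLpNorm b ∞ volume :=
    eLpNorm_norm_mul_norm_le ha hb p ∞ p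
  exact h1.trans (mul_le_mul' h2 h3)

omit hE in
/-- **Absolute convergence of the inner integral**: for `a ∈ L^p` (`1 < p`) and `b`
essentially bounded, `y ↦ K(σ, x-y)[a(y), b(y)]` is integrable for every `x`, `σ > 0`
(domination by the envelope in `L^{p'}` against `|a||b| ∈ L^p`). [folklore] -/
theorem integrable_oseenKernel_slice_Lp {σ : ℝ} (hσ : 0 < σ) {p : ℝ≥0∞} (hp1' : 1 < p)
    {a b : E → E} (ha : MemLp a p volume) (hbm : AEStronglyMeasurable b volume)
    (hb : eLpNorm b ∞ volume < ∞) (x : E) :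
    Integrable (fun y => oseenKernel σ (x - y) (a y) (b y)) volume := by
  have hp1 : 1 ≤ p := hp1'.le
  set p' : ℝ≥0∞ := ENNReal.conjExponent p with hp'
  haveI hHC : p.HolderConjugate p' := .conjExponent hp1
  haveI hHC' : p'.HolderConjugate p := inferInstance
  have hp'1 : 1 ≤ p' := ENNReal.HolderConjugate.one_le p' p
  have hp'top : p' ≠ ∞ := by
    intro h
    have h1 : p⁻¹ + p'⁻¹ = 1 := ENNReal.HolderConjugate.inv_add_inv_eq_one p p'
    rw [h, ENNReal.inv_top, add_zero, ENNReal.inv_eq_one] at h1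
    exact absurd h1 hp1'.ne'
  obtain ⟨C, hC, hK⟩ := exists_norm_oseenKernel_le (E := E)
  set d : ℝ := (Module.finrank ℝ E : ℝ) with hd
  set Env : E → ℝ := fun z => C * (σ + ‖z‖ ^ 2) ^ (-((d + 1) / 2)) with hEnv
  obtain ⟨B, hB0, hB⟩ := exists_eLpNorm_oseenEnvelope_le (E := E) hC.le hp'1 hp'top
  have hEnvm : AEStronglyMeasurable Env volume :=
    (measurable_const.mul ((measurable_const.add (measurable_norm.pow_const 2)).pow
      measurable_const)).aestronglyMeasurable
  have hEnv_mem : MemLp Env p' volume := ⟨hEnvm, (hB σ hσ).trans_lt ENNReal.ofReal_lt_top⟩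
  have hEnv_x : MemLp (fun y => Env (x - y)) p' volume :=
    hEnv_mem.comp_measurePreserving (Measure.measurePreserving_sub_left volume x)
  have hg_mem : MemLp (fun y => ‖a y‖ * ‖b y‖) p volume := by
    have h := MemLp.mul' (p := ∞) (q := p) (r := p) ha.norm ⟨hbm.norm, by rwa [eLpNorm_norm]⟩
    simpa only [mul_comm] using h
  have hprod : Integrable (fun y => Env (x - y) * (‖a y‖ * ‖b y‖)) volume :=
    memLp_one_iff_integrable.1 (hg_mem.mul' hEnv_x)
  refine hprod.mono' ?_ (Eventually.of_forall fun y => ?_)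
  · have h1 : Measurable (fun y : E => ((σ, x - y, ha.1.mk a y, hbm.mk b y) : ℝ × E × E × E)) :=
      measurable_const.prodMk ((measurable_const.sub measurable_id).prodMk
        ((ha.1.stronglyMeasurable_mk.measurable).prodMk hbm.stronglyMeasurable_mk.measurable))
    have h2 : AEStronglyMeasurable (fun y => oseenKernel σ (x - y) (ha.1.mk a y) (hbm.mk b y))
        volume := (measurable_oseenKernel.comp h1).aestronglyMeasurable
    refine h2.congr ?_
    filter_upwards [ha.1.ae_eq_mk, hbm.ae_eq_mk] with y hya hyb
    rw [← hya, ← hyb]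
  · calc ‖oseenKernel σ (x - y) (a y) (b y)‖
        ≤ C * (σ + ‖x - y‖ ^ 2) ^ (-((d + 1) / 2)) * ‖a y‖ * ‖b y‖ := hK hσ _ _ _
      _ = Env (x - y) * (‖a y‖ * ‖b y‖) := by rw [hEnv]; ring

end Slice

/-! ### Kato's estimates for the unit-viscosity Oseen–Duhamel term -/

section Duhamel

variable (hE : Module.finrank ℝ E = 3)
include hE

/-- **Kato's `L^p` estimate of the Duhamel term** (Kato 1984, (2.3)–(2.4), `m = 3`, `q = p`):
there is `c` such that for jointly measurable `u`, `v` with `‖u(τ)‖_{L^p} ≤ K_u τ^{-(1-3/p)/2}`,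
`‖v(τ)‖_{L^p} ≤ K_v τ^{-(1-3/p)/2}` on `(0, t)`,
`‖∫_{(0,t)} ∫ K(t-τ, ·-y)[u(τ,y), v(τ,y)] dy dτ‖_{L^p} ≤ c K_u K_v t^{-(1-3/p)/2}`
(Minkowski in `τ`, the slice bound `∝ (t-τ)^{-1/2-3/(2p)}`, and
`∫₀ᵗ (t-τ)^{-1/2-3/(2p)} τ^{-(1-3/p)} dτ = B t^{-(1-3/p)/2}`). [cite: Kato1984, (2.3)–(2.4)] -/
theorem exists_eLpNorm_oseenDuhamel_le_Lp {p : ℝ≥0∞} (hp₃ : 3 < p) (hp : p < ∞) :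
    ∃ c : ℝ, 0 ≤ c ∧ ∀ {u v : ℝ → E → E}, Measurable (uncurry u) → Measurable (uncurry v) →
      ∀ {Ku Kv : ℝ}, 0 ≤ Ku → 0 ≤ Kv → ∀ {t : ℝ}, 0 < t →
        (∀ τ ∈ Ioo 0 t, eLpNorm (u τ) p volume ≤
          ENNReal.ofReal (Ku * τ ^ (-((1 - 3 / p.toReal) / 2)))) →
        (∀ τ ∈ Ioo 0 t, eLpNorm (v τ) p volume ≤
          ENNReal.ofReal (Kv * τ ^ (-((1 - 3 / p.toReal) / 2)))) →
          eLpNorm (fun x => ∫ τ in Ioo 0 t, ∫ y, oseenKernel (t - τ) (x - y) (u τ y) (v τ y))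
              p volume ≤
            ENNReal.ofReal (c * Ku * Kv * t ^ (-((1 - 3 / p.toReal) / 2))) := by
  obtain ⟨C, hC, hS⟩ := exists_eLpNorm_oseenSlice_le_Lp hE hp₃ hp
  have hr3 := three_lt_toReal hp₃ hp
  have hp1 : 1 ≤ p := (lt_trans (by norm_num) hp₃).le
  set r : ℝ := p.toReal with hr
  set ae : ℝ := 1 / 2 + 3 / (2 * r) with hae
  set s : ℝ := 1 - 3 / r with hs
  have hr0 : 0 < r := by linarith
  have h3r : 3 / r < 1 := by rw [div_lt_one hr0]; exact hr3
  have h3r0 : 0 < 3 / r := by positivity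
  have h3r2 : 3 / (2 * r) < 1 / 2 := by
    rw [div_lt_div_iff₀ (by positivity) (by norm_num)]; linarith
  have hae0 : 0 ≤ ae := by positivity
  have hae1 : ae < 1 := by rw [hae]; linarith
  have hs0 : 0 ≤ s := by rw [hs]; linarith
  have hs1 : s < 1 := by rw [hs]; linarith
  have hexp : 1 - ae - s = -(s / 2) := by
    rw [hae, hs]; field_simp; ring
  set I : ℝ := ∫ x in (0 : ℝ)..1, (1 - x) ^ (-ae) * x ^ (-s) with hI
  have hI0 : 0 ≤ I := integral_one_sub_rpow_mul_rpow_nonneg _ _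
  refine ⟨C * I, by positivity, fun {u v} hum hvm {Ku Kv} hKu hKv {t} ht hu hv => ?_⟩
  set S : ℝ → E → E := fun τ x => ∫ y, oseenKernel (t - τ) (x - y) (u τ y) (v τ y) with hSdef
  have hMink := FunctionSpaces.eLpNorm_integral_le_lintegral_eLpNorm (μ := (volume : Measure E))
    (ν := volume.restrict (Ioo 0 t)) (aestronglyMeasurable_oseenIntegrand_swap_one hum hvm t _)
    (p := p) hp1 hp.ne
  have hslice : ∀ τ ∈ Ioo 0 t, eLpNorm (S τ) p volume ≤
      ENNReal.ofReal (C * Ku * Kv * ((t - τ) ^ (-ae) * τ ^ (-s))) := by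
    intro τ hτ
    have hστ : 0 < t - τ := sub_pos.2 hτ.2
    have hτ0 : 0 < τ := hτ.1
    have h1 := hS hστ (measurable_slice hum τ).aestronglyMeasurable
      (measurable_slice hvm τ).aestronglyMeasurable
    refine h1.trans ?_
    calc ENNReal.ofReal (C * (t - τ) ^ (-ae)) * (eLpNorm (u τ) p volume * eLpNorm (v τ) p volume)
        ≤ ENNReal.ofReal (C * (t - τ) ^ (-ae)) *
            (ENNReal.ofReal (Ku * τ ^ (-(s / 2))) * ENNReal.ofReal (Kv * τ ^ (-(s / 2)))) := by
          gcongr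
          · exact hu τ hτ
          · exact hv τ hτ
      _ = ENNReal.ofReal (C * Ku * Kv * ((t - τ) ^ (-ae) * τ ^ (-s))) := by
          rw [← ENNReal.ofReal_mul (by positivity),
            ← ENNReal.ofReal_mul (mul_nonneg hC (Real.rpow_nonneg hστ.le _))]
          congr 1
          rw [← rpow_neg_half_mul_self hτ0 s]
          ring
  calc eLpNorm (fun x => ∫ τ in Ioo 0 t, S τ x) p volume
      ≤ ∫⁻ τ in Ioo 0 t, eLpNorm (fun x => S τ x) p volume := hMink
    _ ≤ ∫⁻ τ in Ioo 0 t, ENNReal.ofReal (C * Ku * Kv * ((t - τ) ^ (-ae) * τ ^ (-s))) :=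
        setLIntegral_mono' measurableSet_Ioo fun τ hτ => hslice τ hτ
    _ = ENNReal.ofReal (C * Ku * Kv * (t ^ (1 - ae - s) * I)) :=
        lintegral_Ioo_ofReal_sub_rpow_mul_rpow hae0 hae1 hs0 hs1 (by positivity) ht
    _ = ENNReal.ofReal (C * I * Ku * Kv * t ^ (-(s / 2))) := by
        rw [hexp]
        congr 1
        ring

/-- **Kato's pointwise estimate of the Duhamel term and its absolute convergence** (Kato 1984,
(2.4') with `q = ∞`): there is `c` such that for jointly measurable `u`, `v` with
`‖u(τ)‖_{L^p} ≤ K_u τ^{-(1-3/p)/2}` and `‖v(τ)‖_{L^∞} ≤ L_v τ^{-1/2}` on `(0, t)`, the time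
integrand `τ ↦ ∫ K(t-τ, x-y)[u(τ,y), v(τ,y)] dy` is integrable on `(0, t)` for **every** `x`, and
`|∫_{(0,t)} ∫ K[u, v] dy dτ (x)| ≤ c K_u L_v t^{-1/2}` (slice bound `∝ (t-τ)^{-1/2-3/(2p)}`,
`∫₀ᵗ (t-τ)^{-1/2-3/(2p)} τ^{-1+3/(2p)} dτ = B t^{-1/2}`). [cite: Kato1984, (2.4')] -/
theorem exists_norm_oseenDuhamel_le_Lp {p : ℝ≥0∞} (hp₃ : 3 < p) (hp : p < ∞) :
    ∃ c : ℝ, 0 ≤ c ∧ ∀ {u v : ℝ → E → E}, Measurable (uncurry u) → Measurable (uncurry v) →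
      ∀ {Ku Lv : ℝ}, 0 ≤ Ku → 0 ≤ Lv → ∀ {t : ℝ}, 0 < t →
        (∀ τ ∈ Ioo 0 t, eLpNorm (u τ) p volume ≤
          ENNReal.ofReal (Ku * τ ^ (-((1 - 3 / p.toReal) / 2)))) →
        (∀ τ ∈ Ioo 0 t, eLpNorm (v τ) ∞ volume ≤ ENNReal.ofReal (Lv * τ ^ (-(1 / 2 : ℝ)))) →
          ∀ x : E,
            IntegrableOn (fun τ => ∫ y, oseenKernel (t - τ) (x - y) (u τ y) (v τ y))
                (Ioo 0 t) volume ∧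
              ‖∫ τ in Ioo 0 t, ∫ y, oseenKernel (t - τ) (x - y) (u τ y) (v τ y)‖ ≤
                c * Ku * Lv * t ^ (-(1 / 2 : ℝ)) := by
  obtain ⟨C, hC, hS⟩ := exists_enorm_oseenSlice_le_Lp hE hp₃ hp
  have hr3 := three_lt_toReal hp₃ hp
  set r : ℝ := p.toReal with hr
  set ae : ℝ := 1 / 2 + 3 / (2 * r) with hae
  set s : ℝ := 1 - 3 / r with hs
  set be : ℝ := 1 - (1 - s) / 2 with hbe
  have hr0 : 0 < r := by linarith
  have h3r : 3 / r < 1 := by rw [div_lt_one hr0]; exact hr3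
  have h3r0 : 0 < 3 / r := by positivity
  have h3r2 : 3 / (2 * r) < 1 / 2 := by
    rw [div_lt_div_iff₀ (by positivity) (by norm_num)]; linarith
  have hae0 : 0 ≤ ae := by positivity
  have hae1 : ae < 1 := by rw [hae]; linarith
  have hbe0 : 0 ≤ be := by rw [hbe, hs]; linarith
  have hbe1 : be < 1 := by rw [hbe, hs]; linarith
  have hexp : 1 - ae - be = -(1 / 2 : ℝ) := by
    rw [hae, hbe, hs]; field_simp; ring
  set I : ℝ := ∫ x in (0 : ℝ)..1, (1 - x) ^ (-ae) * x ^ (-be) with hI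
  have hI0 : 0 ≤ I := integral_one_sub_rpow_mul_rpow_nonneg _ _
  refine ⟨C * I, by positivity, fun {u v} hum hvm {Ku Lv} hKu hLv {t} ht hu hv x => ?_⟩
  set S : ℝ → E → E := fun τ x => ∫ y, oseenKernel (t - τ) (x - y) (u τ y) (v τ y) with hSdef
  -- the integrable majorant
  set g : ℝ → ℝ := fun τ => C * Ku * Lv * ((t - τ) ^ (-ae) * τ ^ (-be)) with hg
  have hgint : IntegrableOn g (Ioo 0 t) volume := by
    have h := (intervalIntegrable_sub_rpow_mul_rpow hae0 hae1 hbe0 hbe1 ht).const_mul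
      (C * Ku * Lv)
    rw [intervalIntegrable_iff_integrableOn_Ioo_of_le ht.le] at h
    exact h
  have hslice : ∀ τ ∈ Ioo 0 t, ‖S τ x‖ ≤ g τ := by
    intro τ hτ
    have hστ : 0 < t - τ := sub_pos.2 hτ.2
    have hτ0 : 0 < τ := hτ.1
    have h1 := hS hστ (measurable_slice hum τ).aestronglyMeasurable
      (measurable_slice hvm τ).aestronglyMeasurable x
    have h2 : ‖S τ x‖ₑ ≤ ENNReal.ofReal (g τ) := by
      refine h1.trans ?_
      calc ENNReal.ofReal (C * (t - τ) ^ (-ae)) * (eLpNorm (u τ) p volume * eLpNorm (v τ) ∞ volume)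
          ≤ ENNReal.ofReal (C * (t - τ) ^ (-ae)) *
              (ENNReal.ofReal (Ku * τ ^ (-(s / 2))) * ENNReal.ofReal (Lv * τ ^ (-(1 / 2 : ℝ)))) := by
            gcongr
            · exact hu τ hτ
            · exact hv τ hτ
        _ = ENNReal.ofReal (g τ) := by
            rw [← ENNReal.ofReal_mul (by positivity),
              ← ENNReal.ofReal_mul (mul_nonneg hC (Real.rpow_nonneg hστ.le _))]
            congr 1
            simp only [hg]
            rw [hbe, ← rpow_neg_half_mul_neg_half hτ0 s]
            ring
    have hg0 : 0 ≤ g τ := by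
      rw [hg]
      exact mul_nonneg (by positivity) (mul_nonneg (Real.rpow_nonneg hστ.le _)
        (Real.rpow_nonneg hτ0.le _))
    rw [← ofReal_norm] at h2
    exact (ENNReal.ofReal_le_ofReal_iff hg0).1 h2
  have hSxm : AEStronglyMeasurable (fun τ => S τ x) (volume.restrict (Ioo 0 t)) := by
    have h := (stronglyMeasurable_oseenIntegrand_one hum hvm t).comp_measurable
      (measurable_id.prodMk measurable_const : Measurable fun τ : ℝ => (τ, x))
    exact h.aestronglyMeasurable
  have hae' : ∀ᵐ τ ∂(volume.restrict (Ioo 0 t)), ‖S τ x‖ ≤ g τ :=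
    (ae_restrict_iff' measurableSet_Ioo).2 (Eventually.of_forall hslice)
  refine ⟨Integrable.mono' hgint hSxm hae', ?_⟩
  calc ‖∫ τ in Ioo 0 t, S τ x‖ ≤ ∫ τ in Ioo 0 t, g τ := norm_integral_le_of_norm_le hgint hae'
    _ = C * Ku * Lv * (t ^ (1 - ae - be) * I) := by
        rw [hg, integral_const_mul, setIntegral_Ioo_sub_rpow_mul_rpow ht]
    _ = C * I * Ku * Lv * t ^ (-(1 / 2 : ℝ)) := by
        rw [hexp]
        ring

end Duhamel

/-! ### One Picard step and differences of steps: Kato bounds -/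

section Step

/-- Slices of fields in a weighted `L^p` class are in `L^p`. [folklore] -/
theorem memLp_of_katoLp {X : Type*} [MeasureSpace X] {F : Type*} [NormedAddCommGroup F]
    [SecondCountableTopology F] [MeasurableSpace F] [BorelSpace F]
    {w : ℝ → X → F} (hwm : Measurable (uncurry w)) {p : ℝ≥0∞} {t₁ a e : ℝ}
    (hw : ∀ t ∈ Ioo 0 t₁, eLpNorm (w t) p volume ≤ ENNReal.ofReal (a * t ^ e))
    {t : ℝ} (ht : t ∈ Ioo 0 t₁) : MemLp (w t) p volume :=
  ⟨(hwm.comp (measurable_const.prodMk measurable_id)).aestronglyMeasurable,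
    (hw t ht).trans_lt ENNReal.ofReal_lt_top⟩

variable (hE : Module.finrank ℝ E = 3)
include hE

/-- **Kato bounds of one Picard step** `F(w) = U - B(w, w)` (Kato 1984, §2, (2.3)–(2.5)): there
is `c` such that, if `w` is jointly measurable with `‖w(t)‖_{L^p} ≤ a t^{-(1-3/p)/2}` and
`|w(t)(x)| ≤ b t^{-1/2}` on `(0, t₁)`, and the (jointly measurable) free term satisfies
`‖U(t)‖_{L^p} ≤ α₁ t^{-(1-3/p)/2}`, `|U(t)(x)| ≤ β₁ t^{-1/2}` there, then `F(w)` is jointly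
measurable, `‖F(w)(t)‖_{L^p} ≤ (α₁ + c a²) t^{-(1-3/p)/2}` and `|F(w)(t)(x)| ≤ (β₁ + c a b) t^{-1/2}`
on `(0, t₁)`. [cite: Kato1984, §2 (2.3)–(2.5)] -/
theorem exists_katoLp_step_bounds {p : ℝ≥0∞} (hp₃ : 3 < p) (hp : p < ∞) :
    ∃ c : ℝ, 0 ≤ c ∧ ∀ {U w : ℝ → E → E}, Measurable (uncurry U) → Measurable (uncurry w) →
      ∀ {t₁ a b α₁ β₁ : ℝ}, 0 ≤ a → 0 ≤ b → 0 ≤ α₁ → 0 ≤ β₁ →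
        (∀ t ∈ Ioo 0 t₁, eLpNorm (w t) p volume ≤
          ENNReal.ofReal (a * t ^ (-((1 - 3 / p.toReal) / 2)))) →
        (∀ t ∈ Ioo 0 t₁, ∀ x, ‖w t x‖ ≤ b * t ^ (-(1 / 2 : ℝ))) →
        (∀ t ∈ Ioo 0 t₁, eLpNorm (U t) p volume ≤
          ENNReal.ofReal (α₁ * t ^ (-((1 - 3 / p.toReal) / 2)))) →
        (∀ t ∈ Ioo 0 t₁, ∀ x, ‖U t x‖ ≤ β₁ * t ^ (-(1 / 2 : ℝ))) →
          Measurable (uncurry fun (t : ℝ) (x : E) => U t x -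
            ∫ τ in Ioo 0 t, ∫ y, oseenKernel (t - τ) (x - y) (w τ y) (w τ y)) ∧
          (∀ t ∈ Ioo 0 t₁, eLpNorm (fun x => U t x -
              ∫ τ in Ioo 0 t, ∫ y, oseenKernel (t - τ) (x - y) (w τ y) (w τ y)) p volume ≤
            ENNReal.ofReal ((α₁ + c * a * a) * t ^ (-((1 - 3 / p.toReal) / 2)))) ∧
          (∀ t ∈ Ioo 0 t₁, ∀ x, ‖U t x -
              ∫ τ in Ioo 0 t, ∫ y, oseenKernel (t - τ) (x - y) (w τ y) (w τ y)‖ ≤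
            (β₁ + c * a * b) * t ^ (-(1 / 2 : ℝ))) := by
  obtain ⟨c₆, hc₆, H6⟩ := exists_eLpNorm_oseenDuhamel_le_Lp hE hp₃ hp
  obtain ⟨ci, hci, Hi⟩ := exists_norm_oseenDuhamel_le_Lp hE hp₃ hp
  have hp1 : 1 ≤ p := (lt_trans (by norm_num) hp₃).le
  set e₁ : ℝ := -((1 - 3 / p.toReal) / 2) with he₁
  refine ⟨max c₆ ci, le_max_of_le_left hc₆,
    fun {U w} hUm hwm {t₁ a b α₁ β₁} ha hb hα₁ hβ₁ hw6 hwi hU6 hUi => ?_⟩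
  have hBm := measurable_uncurry_oseenDuhamel_one hwm hwm
  have hmeas : Measurable (uncurry fun (t : ℝ) (x : E) => U t x -
      ∫ τ in Ioo 0 t, ∫ y, oseenKernel (t - τ) (x - y) (w τ y) (w τ y)) := hUm.sub hBm
  refine ⟨hmeas, fun t ht => ?_, fun t ht x => ?_⟩
  · -- the `L^p` bound
    have ht0 : 0 < t := ht.1
    have hw6' : ∀ τ ∈ Ioo 0 t, eLpNorm (w τ) p volume ≤ ENNReal.ofReal (a * τ ^ e₁) :=
      fun τ hτ => hw6 τ ⟨hτ.1, hτ.2.trans ht.2⟩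
    have hB6 := H6 hwm hwm ha ha ht0 hw6' hw6'
    have hUs : AEStronglyMeasurable (U t) volume := (measurable_slice hUm t).aestronglyMeasurable
    have hBs : AEStronglyMeasurable (fun x =>
        ∫ τ in Ioo 0 t, ∫ y, oseenKernel (t - τ) (x - y) (w τ y) (w τ y)) volume :=
      (measurable_slice hBm t).aestronglyMeasurable
    calc eLpNorm (fun x => U t x -
          ∫ τ in Ioo 0 t, ∫ y, oseenKernel (t - τ) (x - y) (w τ y) (w τ y)) p volume
        ≤ eLpNorm (U t) p volume + eLpNorm (fun x =>
            ∫ τ in Ioo 0 t, ∫ y, oseenKernel (t - τ) (x - y) (w τ y) (w τ y)) p volume :=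
          eLpNorm_sub_le hUs hBs hp1
      _ ≤ ENNReal.ofReal (α₁ * t ^ e₁) + ENNReal.ofReal (c₆ * a * a * t ^ e₁) :=
          add_le_add (hU6 t ht) hB6
      _ = ENNReal.ofReal ((α₁ + c₆ * a * a) * t ^ e₁) := by
          rw [← ENNReal.ofReal_add (by positivity) (by positivity)]
          congr 1
          ring
      _ ≤ ENNReal.ofReal ((α₁ + max c₆ ci * a * a) * t ^ e₁) := by
          refine ENNReal.ofReal_le_ofReal ?_
          have h1 : c₆ * a * a ≤ max c₆ ci * a * a := by
            gcongr; exact le_max_left _ _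
          have h2 : 0 ≤ t ^ e₁ := Real.rpow_nonneg ht0.le _
          nlinarith
  · -- the pointwise bound
    have ht0 : 0 < t := ht.1
    have hw6' : ∀ τ ∈ Ioo 0 t, eLpNorm (w τ) p volume ≤ ENNReal.ofReal (a * τ ^ e₁) :=
      fun τ hτ => hw6 τ ⟨hτ.1, hτ.2.trans ht.2⟩
    have hwi' : ∀ τ ∈ Ioo 0 t, eLpNorm (w τ) ∞ volume ≤ ENNReal.ofReal (b * τ ^ (-(1 / 2 : ℝ))) :=
      fun τ hτ => eLpNorm_top_le_ofReal_of_norm_le (hwi τ ⟨hτ.1, hτ.2.trans ht.2⟩)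
    have hBi := (Hi hwm hwm ha hb ht0 hw6' hwi' x).2
    have hU := hUi t ht x
    calc ‖U t x - ∫ τ in Ioo 0 t, ∫ y, oseenKernel (t - τ) (x - y) (w τ y) (w τ y)‖
        ≤ ‖U t x‖ + ‖∫ τ in Ioo 0 t, ∫ y, oseenKernel (t - τ) (x - y) (w τ y) (w τ y)‖ :=
          norm_sub_le _ _
      _ ≤ β₁ * t ^ (-(1 / 2 : ℝ)) + ci * a * b * t ^ (-(1 / 2 : ℝ)) := add_le_add hU hBi
      _ ≤ (β₁ + max c₆ ci * a * b) * t ^ (-(1 / 2 : ℝ)) := by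
          have h1 : ci * a * b ≤ max c₆ ci * a * b := by
            gcongr; exact le_max_right _ _
          have h2 : 0 ≤ t ^ (-(1 / 2 : ℝ)) := Real.rpow_nonneg ht0.le _
          nlinarith

/-- **Kato bounds of differences of Picard steps** (Kato 1984, §2, the contraction estimate):
there is `c` such that for jointly measurable `w`, `w'` in the weighted classes on `(0, t₁)`
(constants `(a, b)`, `(a', b')`) whose difference has constants `(e, f)`, one has, on
`(0, t₁) × E`, the bilinear identity `B(w,w) - B(w',w') = B(w - w', w) + B(w', w - w')` (all
integrals absolutely convergent) and the bounds
`‖(B(w,w) - B(w',w'))(t)‖_{L^p} ≤ c (e a + a' e) t^{-(1-3/p)/2}`,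
`|(B(w,w) - B(w',w'))(t)(x)| ≤ c (e b + a' f) t^{-1/2}`. [cite: Kato1984, §2] -/
theorem exists_katoLp_diff_bounds {p : ℝ≥0∞} (hp₃ : 3 < p) (hp : p < ∞) :
    ∃ c : ℝ, 0 ≤ c ∧ ∀ {w w' : ℝ → E → E}, Measurable (uncurry w) → Measurable (uncurry w') →
      ∀ {t₁ a b a' b' e f : ℝ}, 0 ≤ a → 0 ≤ b → 0 ≤ a' → 0 ≤ b' → 0 ≤ e → 0 ≤ f →
        (∀ t ∈ Ioo 0 t₁, eLpNorm (w t) p volume ≤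
          ENNReal.ofReal (a * t ^ (-((1 - 3 / p.toReal) / 2)))) →
        (∀ t ∈ Ioo 0 t₁, ∀ x, ‖w t x‖ ≤ b * t ^ (-(1 / 2 : ℝ))) →
        (∀ t ∈ Ioo 0 t₁, eLpNorm (w' t) p volume ≤
          ENNReal.ofReal (a' * t ^ (-((1 - 3 / p.toReal) / 2)))) →
        (∀ t ∈ Ioo 0 t₁, ∀ x, ‖w' t x‖ ≤ b' * t ^ (-(1 / 2 : ℝ))) →
        (∀ t ∈ Ioo 0 t₁, eLpNorm ((w - w') t) p volume ≤
          ENNReal.ofReal (e * t ^ (-((1 - 3 / p.toReal) / 2)))) →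
        (∀ t ∈ Ioo 0 t₁, ∀ x, ‖(w - w') t x‖ ≤ f * t ^ (-(1 / 2 : ℝ))) →
          (∀ t ∈ Ioo 0 t₁, ∀ x,
            (∫ τ in Ioo 0 t, ∫ y, oseenKernel (t - τ) (x - y) (w τ y) (w τ y)) -
              (∫ τ in Ioo 0 t, ∫ y, oseenKernel (t - τ) (x - y) (w' τ y) (w' τ y)) =
            (∫ τ in Ioo 0 t, ∫ y, oseenKernel (t - τ) (x - y) ((w - w') τ y) (w τ y)) +
              ∫ τ in Ioo 0 t, ∫ y, oseenKernel (t - τ) (x - y) (w' τ y) ((w - w') τ y)) ∧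
          (∀ t ∈ Ioo 0 t₁, eLpNorm (fun x =>
            (∫ τ in Ioo 0 t, ∫ y, oseenKernel (t - τ) (x - y) (w τ y) (w τ y)) -
              ∫ τ in Ioo 0 t, ∫ y, oseenKernel (t - τ) (x - y) (w' τ y) (w' τ y)) p volume ≤
            ENNReal.ofReal (c * (e * a + a' * e) * t ^ (-((1 - 3 / p.toReal) / 2)))) ∧
          (∀ t ∈ Ioo 0 t₁, ∀ x,
            ‖(∫ τ in Ioo 0 t, ∫ y, oseenKernel (t - τ) (x - y) (w τ y) (w τ y)) -
              ∫ τ in Ioo 0 t, ∫ y, oseenKernel (t - τ) (x - y) (w' τ y) (w' τ y)‖ ≤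
            c * (e * b + a' * f) * t ^ (-(1 / 2 : ℝ))) := by
  obtain ⟨c₆, hc₆, H6⟩ := exists_eLpNorm_oseenDuhamel_le_Lp hE hp₃ hp
  obtain ⟨ci, hci, Hi⟩ := exists_norm_oseenDuhamel_le_Lp hE hp₃ hp
  have hp1' : 1 < p := lt_trans (by norm_num) hp₃
  have hp1 : 1 ≤ p := hp1'.le
  set e₁ : ℝ := -((1 - 3 / p.toReal) / 2) with he₁
  refine ⟨max c₆ ci, le_max_of_le_left hc₆, fun {w w'} hwm hwm' {t₁ a b a' b' e f}
    ha hb ha' hb' he hf hw6 hwi hw6' hwi' hd6 hdi => ?_⟩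
  have hdm : Measurable (uncurry (w - w')) := hwm.sub hwm'
  -- restriction of the bounds to `(0, t)`, `t < t₁`, and their `L^∞` forms
  have R6 : ∀ {q : ℝ → E → E} {k : ℝ}, (∀ t ∈ Ioo 0 t₁, eLpNorm (q t) p volume ≤
      ENNReal.ofReal (k * t ^ e₁)) → ∀ {t : ℝ}, t ∈ Ioo 0 t₁ →
      ∀ τ ∈ Ioo 0 t, eLpNorm (q τ) p volume ≤ ENNReal.ofReal (k * τ ^ e₁) := by
    intro q k h t ht τ hτ
    exact h τ ⟨hτ.1, hτ.2.trans ht.2⟩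
  have Ri : ∀ {q : ℝ → E → E} {k : ℝ}, (∀ t ∈ Ioo 0 t₁, ∀ x, ‖q t x‖ ≤ k * t ^ (-(1 / 2 : ℝ))) →
      ∀ {t : ℝ}, t ∈ Ioo 0 t₁ →
      ∀ τ ∈ Ioo 0 t, eLpNorm (q τ) ∞ volume ≤ ENNReal.ofReal (k * τ ^ (-(1 / 2 : ℝ))) := by
    intro q k h t ht τ hτ
    exact eLpNorm_top_le_ofReal_of_norm_le (h τ ⟨hτ.1, hτ.2.trans ht.2⟩)
  -- inner integrability of a pair in the classes at `τ ∈ (0, t)`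
  have Inner : ∀ {q q' : ℝ → E → E} {k l : ℝ}, Measurable (uncurry q) → Measurable (uncurry q') →
      (∀ t ∈ Ioo 0 t₁, eLpNorm (q t) p volume ≤ ENNReal.ofReal (k * t ^ e₁)) →
      (∀ t ∈ Ioo 0 t₁, ∀ x, ‖q' t x‖ ≤ l * t ^ (-(1 / 2 : ℝ))) → ∀ {t : ℝ}, t ∈ Ioo 0 t₁ →
      ∀ (x : E), ∀ τ ∈ Ioo 0 t,
        Integrable (fun y => oseenKernel (t - τ) (x - y) (q τ y) (q' τ y)) volume := by
    intro q q' k l hqm hqm' hq6 hqi t ht x τ hτ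
    have hτ₁ : τ ∈ Ioo 0 t₁ := ⟨hτ.1, hτ.2.trans ht.2⟩
    exact integrable_oseenKernel_slice_Lp (sub_pos.2 hτ.2) hp1' (memLp_of_katoLp hqm hq6 hτ₁)
      (measurable_slice hqm' τ).aestronglyMeasurable
      ((eLpNorm_top_le_ofReal_of_norm_le (hqi τ hτ₁)).trans_lt ENNReal.ofReal_lt_top) x
  -- the identity
  have hident : ∀ t ∈ Ioo 0 t₁, ∀ x,
      (∫ τ in Ioo 0 t, ∫ y, oseenKernel (t - τ) (x - y) (w τ y) (w τ y)) -
        (∫ τ in Ioo 0 t, ∫ y, oseenKernel (t - τ) (x - y) (w' τ y) (w' τ y)) =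
      (∫ τ in Ioo 0 t, ∫ y, oseenKernel (t - τ) (x - y) ((w - w') τ y) (w τ y)) +
        ∫ τ in Ioo 0 t, ∫ y, oseenKernel (t - τ) (x - y) (w' τ y) ((w - w') τ y) := by
    intro t ht x
    have ht0 : 0 < t := ht.1
    -- `B(w, w) = B(w - w', w) + B(w', w)`
    have h1 : (∫ τ in Ioo 0 t, ∫ y, oseenKernel (t - τ) (x - y) (w τ y) (w τ y)) =
        (∫ τ in Ioo 0 t, ∫ y, oseenKernel (t - τ) (x - y) ((w - w') τ y) (w τ y)) +
          ∫ τ in Ioo 0 t, ∫ y, oseenKernel (t - τ) (x - y) (w' τ y) (w τ y) := by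
      have h := oseenDuhamel_add_left_apply_one (u := w - w') (u' := w') (v := w) (t := t)
        (x := x) (Inner hdm hwm hd6 hwi ht x) (Inner hwm' hwm hw6' hwi ht x)
        (Hi hdm hwm he hb ht0 (R6 hd6 ht) (Ri hwi ht) x).1
        (Hi hwm' hwm ha' hb ht0 (R6 hw6' ht) (Ri hwi ht) x).1
      rw [sub_add_cancel] at h
      exact h
    -- `B(w', w) = B(w', w - w') + B(w', w')`
    have h2 : (∫ τ in Ioo 0 t, ∫ y, oseenKernel (t - τ) (x - y) (w' τ y) (w τ y)) =
        (∫ τ in Ioo 0 t, ∫ y, oseenKernel (t - τ) (x - y) (w' τ y) ((w - w') τ y)) +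
          ∫ τ in Ioo 0 t, ∫ y, oseenKernel (t - τ) (x - y) (w' τ y) (w' τ y) := by
      have h := oseenDuhamel_add_right_apply_one (u := w') (v := w - w') (v' := w') (t := t)
        (x := x) (Inner hwm' hdm hw6' hdi ht x) (Inner hwm' hwm' hw6' hwi' ht x)
        (Hi hwm' hdm ha' hf ht0 (R6 hw6' ht) (Ri hdi ht) x).1
        (Hi hwm' hwm' ha' hb' ht0 (R6 hw6' ht) (Ri hwi' ht) x).1
      rw [sub_add_cancel] at h
      exact h
    rw [h1, h2]
    abel
  refine ⟨hident, fun t ht => ?_, fun t ht x => ?_⟩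
  · -- the `L^p` bound of the difference
    have ht0 : 0 < t := ht.1
    have hB1 := H6 hdm hwm he ha ht0 (R6 hd6 ht) (R6 hw6 ht)
    have hB2 := H6 hwm' hdm ha' he ht0 (R6 hw6' ht) (R6 hd6 ht)
    have hm1 : AEStronglyMeasurable (fun x =>
        ∫ τ in Ioo 0 t, ∫ y, oseenKernel (t - τ) (x - y) ((w - w') τ y) (w τ y)) volume :=
      (measurable_slice (measurable_uncurry_oseenDuhamel_one hdm hwm) t).aestronglyMeasurable
    have hm2 : AEStronglyMeasurable (fun x =>
        ∫ τ in Ioo 0 t, ∫ y, oseenKernel (t - τ) (x - y) (w' τ y) ((w - w') τ y)) volume :=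
      (measurable_slice (measurable_uncurry_oseenDuhamel_one hwm' hdm) t).aestronglyMeasurable
    have heq : (fun x => (∫ τ in Ioo 0 t, ∫ y, oseenKernel (t - τ) (x - y) (w τ y) (w τ y)) -
        ∫ τ in Ioo 0 t, ∫ y, oseenKernel (t - τ) (x - y) (w' τ y) (w' τ y)) =
        fun x => (∫ τ in Ioo 0 t, ∫ y, oseenKernel (t - τ) (x - y) ((w - w') τ y) (w τ y)) +
          ∫ τ in Ioo 0 t, ∫ y, oseenKernel (t - τ) (x - y) (w' τ y) ((w - w') τ y) :=
      funext fun x => hident t ht x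
    rw [heq]
    calc eLpNorm (fun x => (∫ τ in Ioo 0 t, ∫ y, oseenKernel (t - τ) (x - y) ((w - w') τ y) (w τ y)) +
          ∫ τ in Ioo 0 t, ∫ y, oseenKernel (t - τ) (x - y) (w' τ y) ((w - w') τ y)) p volume
        ≤ _ := eLpNorm_add_le hm1 hm2 hp1
      _ ≤ ENNReal.ofReal (c₆ * e * a * t ^ e₁) + ENNReal.ofReal (c₆ * a' * e * t ^ e₁) :=
          add_le_add hB1 hB2
      _ = ENNReal.ofReal (c₆ * (e * a + a' * e) * t ^ e₁) := by
          rw [← ENNReal.ofReal_add (by positivity) (by positivity)]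
          congr 1
          ring
      _ ≤ ENNReal.ofReal (max c₆ ci * (e * a + a' * e) * t ^ e₁) := by
          refine ENNReal.ofReal_le_ofReal ?_
          have h2 : 0 ≤ (e * a + a' * e) * t ^ e₁ :=
            mul_nonneg (by positivity) (Real.rpow_nonneg ht0.le _)
          calc c₆ * (e * a + a' * e) * t ^ e₁ = c₆ * ((e * a + a' * e) * t ^ e₁) := by ring
            _ ≤ max c₆ ci * ((e * a + a' * e) * t ^ e₁) :=
                mul_le_mul_of_nonneg_right (le_max_left _ _) h2
            _ = _ := by ring
  · -- the pointwise bound of the difference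
    have ht0 : 0 < t := ht.1
    have hB1 := (Hi hdm hwm he hb ht0 (R6 hd6 ht) (Ri hwi ht) x).2
    have hB2 := (Hi hwm' hdm ha' hf ht0 (R6 hw6' ht) (Ri hdi ht) x).2
    rw [hident t ht x]
    calc ‖(∫ τ in Ioo 0 t, ∫ y, oseenKernel (t - τ) (x - y) ((w - w') τ y) (w τ y)) +
          ∫ τ in Ioo 0 t, ∫ y, oseenKernel (t - τ) (x - y) (w' τ y) ((w - w') τ y)‖
        ≤ _ := norm_add_le _ _
      _ ≤ ci * e * b * t ^ (-(1 / 2 : ℝ)) + ci * a' * f * t ^ (-(1 / 2 : ℝ)) := add_le_add hB1 hB2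
      _ = ci * ((e * b + a' * f) * t ^ (-(1 / 2 : ℝ))) := by ring
      _ ≤ max c₆ ci * ((e * b + a' * f) * t ^ (-(1 / 2 : ℝ))) :=
          mul_le_mul_of_nonneg_right (le_max_right _ _)
            (mul_nonneg (by positivity) (Real.rpow_nonneg ht0.le _))
      _ = max c₆ ci * (e * b + a' * f) * t ^ (-(1 / 2 : ℝ)) := by ring

end Step

/-! ### The iteration and its pointwise limit -/

section Iteration

variable (hE : Module.finrank ℝ E = 3)
include hE

/-- **Kato's fixed point with an abstract free term** (Kato 1984, Thm. 1 and §2, the successive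
approximations (2.6) in the weighted norms (2.1)–(2.2); Lemarié-Rieusset 2016, Thm. 8.7). For
`3 < p < ∞` there is `c > 0` such that: if `U` is jointly measurable with
`‖U(t)‖_{L^p} ≤ α t^{-(1-3/p)/2}` and `|U(t)(x)| ≤ β t^{-1/2}` on `(0, T)`, `α > 0`, `β ≥ 0`,
`c α ≤ 1`, then there is a jointly measurable field `u` on `ℝ × E` with `u(0) = U(0)`, solving
`u(t)(x) = U(t)(x) - ∫_{(0,t)} ∫ K(t-τ, x-y)[u(τ,y), u(τ,y)] dy dτ` at **every** point of
`(0, T) × E`, with `‖u(t)‖_{L^p} ≤ 2α t^{-(1-3/p)/2}` and `|u(t)(x)| ≤ 2(α + β) t^{-1/2}`; and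
the bounds localise: if `c α₁ ≤ 1` and `U` obeys the bounds with `(α₁, β₁)` on `(0, t₁)`,
`t₁ ≤ T`, then `u` obeys them with `(2α₁, 2(α₁ + β₁))` on `(0, t₁)` (the iterates on `(0, t₁)`
only see `(0, t₁)`). The iterates converge at every point because the scheme contracts in the
norm `max(sup t^{(1-3/p)/2}‖·‖_p, θ sup_{t,x} t^{1/2}|·|)`, `θ = α/(α+β)`. [cite: Kato1984, Thm. 1 and §2] -/
theorem exists_katoLp_fixedPoint {p : ℝ≥0∞} (hp₃ : 3 < p) (hp : p < ∞) :
    ∃ c : ℝ, 0 < c ∧ ∀ {U : ℝ → E → E}, Measurable (uncurry U) →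
      ∀ {T α β : ℝ}, 0 < α → 0 ≤ β → c * α ≤ 1 →
        (∀ t ∈ Ioo 0 T, eLpNorm (U t) p volume ≤
          ENNReal.ofReal (α * t ^ (-((1 - 3 / p.toReal) / 2)))) →
        (∀ t ∈ Ioo 0 T, ∀ x, ‖U t x‖ ≤ β * t ^ (-(1 / 2 : ℝ))) →
        ∃ u : ℝ → E → E, Measurable (uncurry u) ∧ u 0 = U 0 ∧
          (∀ t ∈ Ioo 0 T, ∀ x, u t x = U t x -
            ∫ τ in Ioo 0 t, ∫ y, oseenKernel (t - τ) (x - y) (u τ y) (u τ y)) ∧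
          (∀ t ∈ Ioo 0 T, eLpNorm (u t) p volume ≤
            ENNReal.ofReal (2 * α * t ^ (-((1 - 3 / p.toReal) / 2)))) ∧
          (∀ t ∈ Ioo 0 T, ∀ x, ‖u t x‖ ≤ 2 * (α + β) * t ^ (-(1 / 2 : ℝ))) ∧
          (∀ {t₁ α₁ β₁ : ℝ}, t₁ ≤ T → 0 < α₁ → 0 ≤ β₁ → c * α₁ ≤ 1 →
            (∀ t ∈ Ioo 0 t₁, eLpNorm (U t) p volume ≤
              ENNReal.ofReal (α₁ * t ^ (-((1 - 3 / p.toReal) / 2)))) →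
            (∀ t ∈ Ioo 0 t₁, ∀ x, ‖U t x‖ ≤ β₁ * t ^ (-(1 / 2 : ℝ))) →
              (∀ t ∈ Ioo 0 t₁, eLpNorm (u t) p volume ≤
                ENNReal.ofReal (2 * α₁ * t ^ (-((1 - 3 / p.toReal) / 2)))) ∧
              ∀ t ∈ Ioo 0 t₁, ∀ x, ‖u t x‖ ≤ 2 * (α₁ + β₁) * t ^ (-(1 / 2 : ℝ))) := by
  obtain ⟨c₁, hc₁, S1⟩ := exists_katoLp_step_bounds hE hp₃ hp
  obtain ⟨c₂, hc₂, S2⟩ := exists_katoLp_diff_bounds hE hp₃ hp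
  set e₁ : ℝ := -((1 - 3 / p.toReal) / 2) with he₁
  refine ⟨8 * (max c₁ c₂ + 1), by positivity, ?_⟩
  intro U hUm T α β hα hβ hsmall hU6 hUi
  -- ### constants
  set η : ℝ := max c₁ c₂ + 1 with hη
  have hη0 : 0 ≤ η := by positivity
  have hc₁η : c₁ ≤ η := by rw [hη]; linarith [le_max_left c₁ c₂]
  have hc₂η : c₂ ≤ η := by rw [hη]; linarith [le_max_right c₁ c₂]
  have h8 : 8 * η * α ≤ 1 := by rw [hη]; linarith
  -- ### the scheme
  set F : (ℝ → E → E) → ℝ → E → E := fun w t x => U t x -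
    ∫ τ in Ioo 0 t, ∫ y, oseenKernel (t - τ) (x - y) (w τ y) (w τ y) with hF
  set useq : ℕ → ℝ → E → E := fun n => F^[n] U with huseq
  have huseq0 : useq 0 = U := rfl
  have huseq_succ : ∀ n, useq (n + 1) = F (useq n) := fun n => Function.iterate_succ_apply' F n _
  have huseq_succ_apply : ∀ n t x, useq (n + 1) t x = U t x -
      ∫ τ in Ioo 0 t, ∫ y, oseenKernel (t - τ) (x - y) (useq n τ y) (useq n τ y) := by
    intro n t x; rw [huseq_succ]
  -- ### (S3) uniform bounds on all iterates (on any `(0, t₁)` where the free term is small)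
  have bounds : ∀ {t₁ α₁ β₁ : ℝ}, 0 < α₁ → 0 ≤ β₁ → 8 * η * α₁ ≤ 1 →
      (∀ t ∈ Ioo 0 t₁, eLpNorm (U t) p volume ≤ ENNReal.ofReal (α₁ * t ^ e₁)) →
      (∀ t ∈ Ioo 0 t₁, ∀ x, ‖U t x‖ ≤ β₁ * t ^ (-(1 / 2 : ℝ))) →
      ∀ n, Measurable (uncurry (useq n)) ∧
        (∀ t ∈ Ioo 0 t₁, eLpNorm (useq n t) p volume ≤ ENNReal.ofReal (2 * α₁ * t ^ e₁)) ∧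
        (∀ t ∈ Ioo 0 t₁, ∀ x, ‖useq n t x‖ ≤ 2 * (α₁ + β₁) * t ^ (-(1 / 2 : ℝ))) := by
    intro t₁ α₁ β₁ hα₁ hβ₁ h8₁ hU₁ hUi₁ n
    induction n with
    | zero =>
      refine ⟨hUm, fun t ht => (hU₁ t ht).trans (ENNReal.ofReal_le_ofReal ?_), fun t ht x =>
        (hUi₁ t ht x).trans ?_⟩
      · have : 0 ≤ t ^ e₁ := Real.rpow_nonneg ht.1.le _
        nlinarith
      · have : 0 ≤ t ^ (-(1 / 2 : ℝ)) := Real.rpow_nonneg ht.1.le _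
        nlinarith
    | succ n ih =>
      obtain ⟨hm, h6, hi⟩ := ih
      have h := S1 hUm hm (t₁ := t₁) (a := 2 * α₁) (b := 2 * (α₁ + β₁)) (α₁ := α₁) (β₁ := β₁)
        (by positivity) (by positivity) hα₁.le hβ₁ h6 hi hU₁ hUi₁
      rw [huseq_succ]
      refine ⟨h.1, fun t ht => (h.2.1 t ht).trans (ENNReal.ofReal_le_ofReal ?_), fun t ht x =>
        (h.2.2 t ht x).trans ?_⟩
      · have ht4 : 0 ≤ t ^ e₁ := Real.rpow_nonneg ht.1.le _
        have hkey : α₁ + c₁ * (2 * α₁) * (2 * α₁) ≤ 2 * α₁ := by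
          have : c₁ * (2 * α₁) * (2 * α₁) ≤ η * (2 * α₁) * (2 * α₁) := by gcongr
          nlinarith
        exact mul_le_mul_of_nonneg_right hkey ht4
      · have ht2 : 0 ≤ t ^ (-(1 / 2 : ℝ)) := Real.rpow_nonneg ht.1.le _
        have hkey : β₁ + c₁ * (2 * α₁) * (2 * (α₁ + β₁)) ≤ 2 * (α₁ + β₁) := by
          have : c₁ * (2 * α₁) * (2 * (α₁ + β₁)) ≤ η * (2 * α₁) * (2 * (α₁ + β₁)) := by gcongr
          nlinarith
        exact mul_le_mul_of_nonneg_right hkey ht2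
  -- the global instance
  have gb := fun n => bounds (t₁ := T) hα hβ h8 hU6 hUi n
  have hm : ∀ n, Measurable (uncurry (useq n)) := fun n => (gb n).1
  -- ### (S4) geometric decay of the differences
  have diffs : ∀ n,
      (∀ t ∈ Ioo 0 T, eLpNorm ((useq (n + 1) - useq n) t) p volume ≤
        ENNReal.ofReal (η * α ^ 2 * (1 / 2) ^ n * t ^ e₁)) ∧
      (∀ t ∈ Ioo 0 T, ∀ x, ‖(useq (n + 1) - useq n) t x‖ ≤
        η * α * (α + β) * (1 / 2) ^ n * t ^ (-(1 / 2 : ℝ))) := by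
    intro n
    induction n with
    | zero =>
      -- `u₁ - u₀ = -(B(U,U) - B(0,0))`
      have hz6 : ∀ t ∈ Ioo 0 T, eLpNorm ((0 : ℝ → E → E) t) p volume ≤
          ENNReal.ofReal (0 * t ^ e₁) := by
        intro t ht; simp
      have hzi : ∀ t ∈ Ioo 0 T, ∀ x, ‖(0 : ℝ → E → E) t x‖ ≤ 0 * t ^ (-(1 / 2 : ℝ)) := by
        intro t ht x; simp
      have hd6 : ∀ t ∈ Ioo 0 T, eLpNorm ((U - 0) t) p volume ≤ ENNReal.ofReal (α * t ^ e₁) := by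
        intro t ht; rw [sub_zero]; exact hU6 t ht
      have hdi : ∀ t ∈ Ioo 0 T, ∀ x, ‖(U - 0) t x‖ ≤ β * t ^ (-(1 / 2 : ℝ)) := by
        intro t ht x; rw [sub_zero]; exact hUi t ht x
      have hzm : Measurable (uncurry (0 : ℝ → E → E)) := measurable_const
      have h := S2 hUm hzm (t₁ := T) hα.le hβ le_rfl le_rfl hα.le hβ hU6 hUi hz6 hzi hd6 hdi
      obtain ⟨-, h6, hi⟩ := h
      have hB0 : ∀ t x, (∫ τ in Ioo 0 t, ∫ y, oseenKernel (t - τ) (x - y)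
          ((0 : ℝ → E → E) τ y) ((0 : ℝ → E → E) τ y)) = 0 := by
        intro t x; simp
      have hrel : ∀ t x, (useq (0 + 1) - useq 0) t x =
          -((∫ τ in Ioo 0 t, ∫ y, oseenKernel (t - τ) (x - y) (U τ y) (U τ y)) -
            ∫ τ in Ioo 0 t, ∫ y, oseenKernel (t - τ) (x - y)
              ((0 : ℝ → E → E) τ y) ((0 : ℝ → E → E) τ y)) := by
        intro t x
        rw [hB0, sub_zero, Pi.sub_apply, Pi.sub_apply, huseq_succ_apply, huseq0]
        abel
      refine ⟨fun t ht => ?_, fun t ht x => ?_⟩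
      · have heq : (useq (0 + 1) - useq 0) t = -fun x =>
            ((∫ τ in Ioo 0 t, ∫ y, oseenKernel (t - τ) (x - y) (U τ y) (U τ y)) -
              ∫ τ in Ioo 0 t, ∫ y, oseenKernel (t - τ) (x - y)
                ((0 : ℝ → E → E) τ y) ((0 : ℝ → E → E) τ y)) := by
          funext x; rw [Pi.neg_apply]; exact hrel t x
        rw [heq, eLpNorm_neg]
        refine (h6 t ht).trans (ENNReal.ofReal_le_ofReal ?_)
        have ht4 : 0 ≤ t ^ e₁ := Real.rpow_nonneg ht.1.le _
        have : c₂ * (α * α + 0 * α) ≤ η * α ^ 2 := by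
          rw [zero_mul, add_zero, ← sq]; exact mul_le_mul_of_nonneg_right hc₂η (sq_nonneg _)
        calc c₂ * (α * α + 0 * α) * t ^ e₁ ≤ η * α ^ 2 * t ^ e₁ :=
              mul_le_mul_of_nonneg_right this ht4
          _ = η * α ^ 2 * (1 / 2) ^ 0 * t ^ e₁ := by rw [pow_zero, mul_one]
      · rw [hrel t x, norm_neg]
        refine (hi t ht x).trans ?_
        have ht2 : 0 ≤ t ^ (-(1 / 2 : ℝ)) := Real.rpow_nonneg ht.1.le _
        have : c₂ * (α * β + 0 * β) ≤ η * α * (α + β) := by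
          rw [zero_mul, add_zero]
          calc c₂ * (α * β) ≤ η * (α * β) := mul_le_mul_of_nonneg_right hc₂η (by positivity)
            _ ≤ η * α * (α + β) := by
                have : 0 ≤ η * α * α := by positivity
                nlinarith
        calc c₂ * (α * β + 0 * β) * t ^ (-(1 / 2 : ℝ))
            ≤ η * α * (α + β) * t ^ (-(1 / 2 : ℝ)) := mul_le_mul_of_nonneg_right this ht2
          _ = η * α * (α + β) * (1 / 2) ^ 0 * t ^ (-(1 / 2 : ℝ)) := by rw [pow_zero, mul_one]
    | succ n ih =>
      obtain ⟨ih6, ihi⟩ := ih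
      obtain ⟨_, hw6, hwi⟩ := gb (n + 1)
      obtain ⟨_, hw6', hwi'⟩ := gb n
      have h := S2 (hm (n + 1)) (hm n) (t₁ := T) (by positivity) (by positivity) (by positivity)
        (by positivity) (by positivity) (by positivity) hw6 hwi hw6' hwi' ih6 ihi
      obtain ⟨-, h6, hi⟩ := h
      have hrel : ∀ t x, (useq (n + 1 + 1) - useq (n + 1)) t x =
          -((∫ τ in Ioo 0 t, ∫ y, oseenKernel (t - τ) (x - y) (useq (n + 1) τ y) (useq (n + 1) τ y)) -
            ∫ τ in Ioo 0 t, ∫ y, oseenKernel (t - τ) (x - y) (useq n τ y) (useq n τ y)) := by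
        intro t x
        rw [Pi.sub_apply, Pi.sub_apply, huseq_succ_apply, huseq_succ_apply]
        abel
      refine ⟨fun t ht => ?_, fun t ht x => ?_⟩
      · have heq : (useq (n + 1 + 1) - useq (n + 1)) t = -fun x =>
            ((∫ τ in Ioo 0 t, ∫ y, oseenKernel (t - τ) (x - y) (useq (n + 1) τ y) (useq (n + 1) τ y)) -
              ∫ τ in Ioo 0 t, ∫ y, oseenKernel (t - τ) (x - y) (useq n τ y) (useq n τ y)) := by
          funext x; rw [Pi.neg_apply]; exact hrel t x
        rw [heq, eLpNorm_neg]
        refine (h6 t ht).trans (ENNReal.ofReal_le_ofReal ?_)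
        have ht4 : 0 ≤ t ^ e₁ := Real.rpow_nonneg ht.1.le _
        set eN : ℝ := η * α ^ 2 * (1 / 2) ^ n with heN
        have heN0 : 0 ≤ eN := by positivity
        have hkey : c₂ * (eN * (2 * α) + 2 * α * eN) ≤ η * α ^ 2 * (1 / 2) ^ (n + 1) := by
          calc c₂ * (eN * (2 * α) + 2 * α * eN)
              ≤ η * (eN * (2 * α) + 2 * α * eN) := mul_le_mul_of_nonneg_right hc₂η (by positivity)
            _ = (8 * η * α) * (eN * (1 / 2)) := by ring
            _ ≤ 1 * (eN * (1 / 2)) := mul_le_mul_of_nonneg_right h8 (by positivity)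
            _ = η * α ^ 2 * (1 / 2) ^ (n + 1) := by rw [heN, pow_succ]; ring
        exact mul_le_mul_of_nonneg_right hkey ht4
      · rw [hrel t x, norm_neg]
        refine (hi t ht x).trans ?_
        have ht2 : 0 ≤ t ^ (-(1 / 2 : ℝ)) := Real.rpow_nonneg ht.1.le _
        set eN : ℝ := η * α ^ 2 * (1 / 2) ^ n with heN
        set fN : ℝ := η * α * (α + β) * (1 / 2) ^ n with hfN
        have hkey : c₂ * (eN * (2 * (α + β)) + 2 * α * fN) ≤
            η * α * (α + β) * (1 / 2) ^ (n + 1) := by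
          have hsum : eN * (2 * (α + β)) + 2 * α * fN = 4 * α * fN := by
            rw [heN, hfN]; ring
          rw [hsum]
          calc c₂ * (4 * α * fN)
              ≤ η * (4 * α * fN) := mul_le_mul_of_nonneg_right hc₂η (by positivity)
            _ = (8 * η * α) * (fN * (1 / 2)) := by ring
            _ ≤ 1 * (fN * (1 / 2)) := mul_le_mul_of_nonneg_right h8 (by positivity)
            _ = η * α * (α + β) * (1 / 2) ^ (n + 1) := by rw [hfN, pow_succ]; ring
        exact mul_le_mul_of_nonneg_right hkey ht2
  -- ### (S5) pointwise convergence of the iterates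
  have hdist : ∀ t ∈ Ioo 0 T, ∀ x, ∀ n, dist (useq n t x) (useq (n + 1) t x) ≤
      (η * α * (α + β) * t ^ (-(1 / 2 : ℝ))) * (1 / 2 : ℝ) ^ n := by
    intro t ht x n
    rw [dist_comm, dist_eq_norm]
    have h := (diffs n).2 t ht x
    rw [Pi.sub_apply, Pi.sub_apply] at h
    calc ‖useq (n + 1) t x - useq n t x‖ ≤ η * α * (α + β) * (1 / 2 : ℝ) ^ n * t ^ (-(1 / 2 : ℝ)) := h
      _ = _ := by ring
  have hcauchy : ∀ t ∈ Ioo 0 T, ∀ x, CauchySeq (fun n => useq n t x) := fun t ht x =>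
    cauchySeq_of_le_geometric (1 / 2 : ℝ) _ (by norm_num) (hdist t ht x)
  -- the limit field
  set ulim : ℝ → E → E := fun t x =>
    if t ∈ Ioo 0 T then limUnder atTop (fun n => useq n t x) else U t x with hulim
  have hconv : ∀ t ∈ Ioo 0 T, ∀ x, Tendsto (fun n => useq n t x) atTop (𝓝 (ulim t x)) := by
    intro t ht x
    have h := (hcauchy t ht x).tendsto_limUnder
    simp only [hulim, if_pos ht]
    exact h
  have htail_pt : ∀ n, ∀ t ∈ Ioo 0 T, ∀ x, ‖(useq n - ulim) t x‖ ≤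
      2 * (η * α * (α + β)) * (1 / 2 : ℝ) ^ n * t ^ (-(1 / 2 : ℝ)) := by
    intro n t ht x
    have h := dist_le_of_le_geometric_of_tendsto (1 / 2 : ℝ) _ (by norm_num) (hdist t ht x)
      (hconv t ht x) n
    rw [dist_eq_norm] at h
    rw [Pi.sub_apply, Pi.sub_apply]
    calc ‖useq n t x - ulim t x‖
        ≤ η * α * (α + β) * t ^ (-(1 / 2 : ℝ)) * (1 / 2 : ℝ) ^ n / (1 - 1 / 2) := h
      _ = _ := by ring
  -- measurability of the limit
  have hulim_m : Measurable (uncurry ulim) := by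
    set S : Set (ℝ × E) := Ioo 0 T ×ˢ univ with hS
    have hSm : MeasurableSet S := measurableSet_Ioo.prod MeasurableSet.univ
    set g : ℕ → ℝ × E → E := fun n q =>
      if q ∈ S then uncurry (useq n) q else uncurry U q with hg
    have hgm : ∀ n, Measurable (g n) := fun n => Measurable.ite hSm (hm n) hUm
    have hlim : Tendsto g atTop (𝓝 (uncurry ulim)) := by
      rw [tendsto_pi_nhds]
      intro q
      by_cases hq : q ∈ S
      · have hq1 : q.1 ∈ Ioo 0 T := (mem_prod.1 hq).1
        have h := hconv q.1 hq1 q.2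
        have heq : (fun n => g n q) = fun n => useq n q.1 q.2 := by
          funext n; simp only [hg, if_pos hq, uncurry]
        rw [heq]
        exact h
      · have heq : (fun n => g n q) = fun _ => U q.1 q.2 := by
          funext n; simp only [hg, if_neg hq, uncurry]
        have hq1 : q.1 ∉ Ioo 0 T := fun h => hq (mem_prod.2 ⟨h, mem_univ _⟩)
        have hval : uncurry ulim q = U q.1 q.2 := by
          simp only [uncurry, hulim, if_neg hq1]
        rw [heq, hval]
        exact tendsto_const_nhds
    exact measurable_of_tendsto_metrizable hgm hlim
  -- `u(0) = U(0)`
  have hulim0 : ulim 0 = U 0 := by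
    funext x
    have h0 : (0 : ℝ) ∉ Ioo 0 T := fun h => lt_irrefl _ h.1
    simp only [hulim, if_neg h0]
  -- localised bounds of the limit (pointwise: limit of the iterate bounds; `L^p`: Fatou)
  have hulim_loc : ∀ {t₁ α₁ β₁ : ℝ}, t₁ ≤ T → 0 < α₁ → 0 ≤ β₁ → 8 * η * α₁ ≤ 1 →
      (∀ t ∈ Ioo 0 t₁, eLpNorm (U t) p volume ≤ ENNReal.ofReal (α₁ * t ^ e₁)) →
      (∀ t ∈ Ioo 0 t₁, ∀ x, ‖U t x‖ ≤ β₁ * t ^ (-(1 / 2 : ℝ))) →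
      (∀ t ∈ Ioo 0 t₁, eLpNorm (ulim t) p volume ≤ ENNReal.ofReal (2 * α₁ * t ^ e₁)) ∧
        ∀ t ∈ Ioo 0 t₁, ∀ x, ‖ulim t x‖ ≤ 2 * (α₁ + β₁) * t ^ (-(1 / 2 : ℝ)) := by
    intro t₁ α₁ β₁ ht₁ hα₁ hβ₁ h8₁ hU₁ hUi₁
    have lb := fun n => bounds hα₁ hβ₁ h8₁ hU₁ hUi₁ n
    refine ⟨fun t ht => ?_, fun t ht x => ?_⟩
    · have htT : t ∈ Ioo 0 T := ⟨ht.1, ht.2.trans_le ht₁⟩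
      have hFatou := MeasureTheory.Lp.eLpNorm_lim_le_liminf_eLpNorm (p := p)
        (μ := (volume : Measure E)) (f := fun n => useq n t)
        (fun n => (measurable_slice (hm n) t).aestronglyMeasurable) (ulim t)
        (Eventually.of_forall fun x => hconv t htT x)
      refine hFatou.trans (Filter.liminf_le_of_le (by isBoundedDefault) fun b hb => ?_)
      obtain ⟨n, hn⟩ := hb.exists
      exact hn.trans ((lb n).2.1 t ht)
    · have htT : t ∈ Ioo 0 T := ⟨ht.1, ht.2.trans_le ht₁⟩
      exact le_of_tendsto ((continuous_norm.tendsto _).comp (hconv t htT x))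
        (Eventually.of_forall fun n => (lb n).2.2 t ht x)
  have hulim_6 : ∀ t ∈ Ioo 0 T, eLpNorm (ulim t) p volume ≤ ENNReal.ofReal (2 * α * t ^ e₁) :=
    (hulim_loc le_rfl hα hβ h8 hU6 hUi).1
  have hulim_i : ∀ t ∈ Ioo 0 T, ∀ x, ‖ulim t x‖ ≤ 2 * (α + β) * t ^ (-(1 / 2 : ℝ)) :=
    (hulim_loc le_rfl hα hβ h8 hU6 hUi).2
  -- `L^p` tail: telescoping and Fatou
  have hp1 : 1 ≤ p := (lt_trans (by norm_num) hp₃).le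
  have htele : ∀ n m, n ≤ m → ∀ t ∈ Ioo 0 T, eLpNorm ((useq n - useq m) t) p volume ≤
      ENNReal.ofReal (η * α ^ 2 * (2 * (1 / 2 : ℝ) ^ n - 2 * (1 / 2 : ℝ) ^ m) * t ^ e₁) := by
    intro n m hnm t ht
    induction m, hnm using Nat.le_induction with
    | base => simp
    | succ m hnm ih =>
      have hsplit : (useq n - useq (m + 1)) t =
          (useq n - useq m) t + -((useq (m + 1) - useq m) t) := by
        funext x; simp only [Pi.sub_apply, Pi.add_apply, Pi.neg_apply]; abel
      have hm1 : AEStronglyMeasurable ((useq n - useq m) t) volume :=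
        ((measurable_slice (hm n) t).sub (measurable_slice (hm m) t)).aestronglyMeasurable
      have hm2 : AEStronglyMeasurable (-((useq (m + 1) - useq m) t)) volume :=
        ((measurable_slice (hm (m + 1)) t).sub (measurable_slice (hm m) t)).aestronglyMeasurable.neg
      have hpow : (1 / 2 : ℝ) ^ m ≤ (1 / 2 : ℝ) ^ n :=
        pow_le_pow_of_le_one (by norm_num) (by norm_num) hnm
      have ht4 : 0 ≤ t ^ e₁ := Real.rpow_nonneg ht.1.le _
      rw [hsplit]
      calc eLpNorm ((useq n - useq m) t + -((useq (m + 1) - useq m) t)) p volume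
          ≤ eLpNorm ((useq n - useq m) t) p volume +
              eLpNorm (-((useq (m + 1) - useq m) t)) p volume := eLpNorm_add_le hm1 hm2 hp1
        _ ≤ ENNReal.ofReal (η * α ^ 2 * (2 * (1 / 2 : ℝ) ^ n - 2 * (1 / 2 : ℝ) ^ m) * t ^ e₁) +
              ENNReal.ofReal (η * α ^ 2 * (1 / 2 : ℝ) ^ m * t ^ e₁) := by
            rw [eLpNorm_neg]; exact add_le_add ih ((diffs m).1 t ht)
        _ = ENNReal.ofReal (η * α ^ 2 * (2 * (1 / 2 : ℝ) ^ n - 2 * (1 / 2 : ℝ) ^ (m + 1)) * t ^ e₁) := by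
            rw [← ENNReal.ofReal_add (mul_nonneg (mul_nonneg (by positivity) (by linarith)) ht4)
              (by positivity)]
            congr 1
            rw [pow_succ]
            ring
  have htail6 : ∀ n, ∀ t ∈ Ioo 0 T, eLpNorm ((useq n - ulim) t) p volume ≤
      ENNReal.ofReal (2 * (η * α ^ 2) * (1 / 2 : ℝ) ^ n * t ^ e₁) := by
    intro n t ht
    have hms : ∀ m, AEStronglyMeasurable ((useq n - useq m) t) volume := fun m =>
      ((measurable_slice (hm n) t).sub (measurable_slice (hm m) t)).aestronglyMeasurable
    have hFatou := MeasureTheory.Lp.eLpNorm_lim_le_liminf_eLpNorm (p := p)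
      (μ := (volume : Measure E)) (f := fun m => (useq n - useq m) t) hms ((useq n - ulim) t)
      (Eventually.of_forall fun x => by
        simp only [Pi.sub_apply]
        exact tendsto_const_nhds.sub (hconv t ht x))
    refine hFatou.trans (Filter.liminf_le_of_le (by isBoundedDefault) fun b hb => ?_)
    obtain ⟨m, hbm, hnm⟩ := (hb.and (eventually_ge_atTop n)).exists
    refine hbm.trans ((htele n m hnm t ht).trans (ENNReal.ofReal_le_ofReal ?_))
    have ht4 : 0 ≤ t ^ e₁ := Real.rpow_nonneg ht.1.le _
    have : η * α ^ 2 * (2 * (1 / 2 : ℝ) ^ n - 2 * (1 / 2 : ℝ) ^ m) ≤ 2 * (η * α ^ 2) * (1 / 2 : ℝ) ^ n := by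
      have : 0 ≤ (1 / 2 : ℝ) ^ m := by positivity
      nlinarith [mul_nonneg hη0 (sq_nonneg α)]
    exact mul_le_mul_of_nonneg_right this ht4
  -- ### the fixed point identity at every point of `(0, T) × E`
  have hfix : ∀ t ∈ Ioo 0 T, ∀ x, ulim t x = U t x -
      ∫ τ in Ioo 0 t, ∫ y, oseenKernel (t - τ) (x - y) (ulim τ y) (ulim τ y) := by
    intro t ht x
    have ht2 : 0 ≤ t ^ (-(1 / 2 : ℝ)) := Real.rpow_nonneg ht.1.le _
    -- `B(u_n, u_n)(t)(x) → B(u, u)(t)(x)`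
    have hbd : ∀ n, ‖(∫ τ in Ioo 0 t, ∫ y, oseenKernel (t - τ) (x - y) (useq n τ y) (useq n τ y)) -
        ∫ τ in Ioo 0 t, ∫ y, oseenKernel (t - τ) (x - y) (ulim τ y) (ulim τ y)‖ ≤
        (c₂ * (8 * (η * α ^ 2) * (α + β)) * t ^ (-(1 / 2 : ℝ))) * (1 / 2 : ℝ) ^ n := by
      intro n
      have h := (S2 (hm n) hulim_m (t₁ := T) (a := 2 * α) (b := 2 * (α + β)) (a' := 2 * α)
        (b' := 2 * (α + β)) (e := 2 * (η * α ^ 2) * (1 / 2 : ℝ) ^ n)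
        (f := 2 * (η * α * (α + β)) * (1 / 2 : ℝ) ^ n)
        (by positivity) (by positivity) (by positivity) (by positivity) (by positivity)
        (by positivity) (gb n).2.1 (gb n).2.2 hulim_6 hulim_i (htail6 n) (htail_pt n)).2.2 t ht x
      refine h.trans (le_of_eq ?_)
      ring
    have hB : Tendsto (fun n => ∫ τ in Ioo 0 t, ∫ y, oseenKernel (t - τ) (x - y)
        (useq n τ y) (useq n τ y)) atTop
        (𝓝 (∫ τ in Ioo 0 t, ∫ y, oseenKernel (t - τ) (x - y) (ulim τ y) (ulim τ y))) := by
      rw [tendsto_iff_norm_sub_tendsto_zero]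
      have hgeo : Tendsto (fun n : ℕ => (c₂ * (8 * (η * α ^ 2) * (α + β)) *
          t ^ (-(1 / 2 : ℝ))) * (1 / 2 : ℝ) ^ n) atTop (𝓝 0) := by
        have h := (tendsto_pow_atTop_nhds_zero_of_lt_one (by norm_num : (0 : ℝ) ≤ 1 / 2)
          (by norm_num : (1 / 2 : ℝ) < 1)).const_mul
          (c₂ * (8 * (η * α ^ 2) * (α + β)) * t ^ (-(1 / 2 : ℝ)))
        rwa [mul_zero] at h
      exact squeeze_zero (fun n => norm_nonneg _) hbd hgeo
    have h1 : Tendsto (fun n => useq (n + 1) t x) atTop (𝓝 (ulim t x)) :=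
      (hconv t ht x).comp (tendsto_add_atTop_nat 1)
    have h2 : Tendsto (fun n => useq (n + 1) t x) atTop (𝓝 (U t x -
        ∫ τ in Ioo 0 t, ∫ y, oseenKernel (t - τ) (x - y) (ulim τ y) (ulim τ y))) := by
      have heq : (fun n => useq (n + 1) t x) = fun n => U t x -
          ∫ τ in Ioo 0 t, ∫ y, oseenKernel (t - τ) (x - y) (useq n τ y) (useq n τ y) :=
        funext fun n => huseq_succ_apply n t x
      rw [heq]
      exact tendsto_const_nhds.sub hB
    exact tendsto_nhds_unique h1 h2
  -- ### conclusion
  exact ⟨ulim, hulim_m, hulim0, hfix, hulim_6, hulim_i,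
    fun {t₁ α₁ β₁} ht₁ hα₁ hβ₁ hs₁ hU₁ hUi₁ => hulim_loc ht₁ hα₁ hβ₁ (by rw [hη]; linarith) hU₁ hUi₁⟩

/-- **Kato's fixed point for the free heat evolution** `U = e^{tΔ}v₀ = heatTest 1 v₀` of a
strongly measurable datum (Kato 1984, Thm. 1 and §2), in terms of the unit-viscosity bilinear
Duhamel operator `kochTataruBilinear`: for `3 < p < ∞` there is `c > 0` such that, whenever
`‖e^{tΔ}v₀‖_{L^p} ≤ a t^{-(1-3/p)/2}` and `|e^{tΔ}v₀(x)| ≤ b t^{-1/2}` on `(0, T)` with `c a ≤ 1`,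
there is a jointly measurable `u` with `u(t)(x) = e^{tΔ}v₀(x) - B(u,u)(t)(x)` at every point of
`(0, T) × E`, `‖u(t)‖_{L^p} ≤ 2a t^{-(1-3/p)/2}`, `|u(t)(x)| ≤ 2(a+b) t^{-1/2}`, and the bounds
localise in time as in `exists_katoLp_fixedPoint`. [cite: Kato1984, Thm. 1 and §2] -/
theorem exists_katoLp_fixedPoint_heatTest {p : ℝ≥0∞} (hp₃ : 3 < p) (hp : p < ∞) :
    ∃ c : ℝ, 0 < c ∧ ∀ ⦃v₀ : E → E⦄, StronglyMeasurable v₀ →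
      ∀ ⦃T a b : ℝ⦄, 0 < T → 0 < a → 0 ≤ b → c * a ≤ 1 →
        (∀ t ∈ Ioo 0 T, eLpNorm (heatTest 1 v₀ t) p volume ≤
            ENNReal.ofReal (a * t ^ (-((1 - 3 / p.toReal) / 2)))) →
        (∀ t ∈ Ioo 0 T, ∀ x, ‖heatTest 1 v₀ t x‖ ≤ b * t ^ (-(1 / 2 : ℝ))) →
        ∃ u : ℝ → E → E, Measurable (uncurry u) ∧
          (∀ t ∈ Ioo 0 T, ∀ x, u t x = heatTest 1 v₀ t x - kochTataruBilinear u u t x) ∧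
          (∀ t ∈ Ioo 0 T, eLpNorm (u t) p volume ≤
              ENNReal.ofReal (2 * a * t ^ (-((1 - 3 / p.toReal) / 2)))) ∧
          (∀ t ∈ Ioo 0 T, ∀ x, ‖u t x‖ ≤ 2 * (a + b) * t ^ (-(1 / 2 : ℝ))) ∧
          ∀ ⦃t₁ a₁ b₁ : ℝ⦄, t₁ ≤ T → 0 < a₁ → 0 ≤ b₁ → c * a₁ ≤ 1 →
            (∀ t ∈ Ioo 0 t₁, eLpNorm (heatTest 1 v₀ t) p volume ≤
                ENNReal.ofReal (a₁ * t ^ (-((1 - 3 / p.toReal) / 2)))) →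
            (∀ t ∈ Ioo 0 t₁, ∀ x, ‖heatTest 1 v₀ t x‖ ≤ b₁ * t ^ (-(1 / 2 : ℝ))) →
              (∀ t ∈ Ioo 0 t₁, eLpNorm (u t) p volume ≤
                  ENNReal.ofReal (2 * a₁ * t ^ (-((1 - 3 / p.toReal) / 2)))) ∧
                ∀ t ∈ Ioo 0 t₁, ∀ x, ‖u t x‖ ≤ 2 * (a₁ + b₁) * t ^ (-(1 / 2 : ℝ)) := by
  obtain ⟨c, hc, H⟩ := exists_katoLp_fixedPoint hE hp₃ hp
  refine ⟨c, hc, fun v₀ hv₀ T a b _ ha hb hca hU hUi => ?_⟩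
  obtain ⟨u, hum, -, hfix, hLp, hLi, hloc⟩ :=
    H (measurable_uncurry_heatTest hv₀ 1) (T := T) ha hb hca hU hUi
  refine ⟨u, hum, fun t ht x => ?_, hLp, hLi,
    fun t₁ a₁ b₁ ht₁ ha₁ hb₁ hca₁ hU₁ hUi₁ => hloc ht₁ ha₁ hb₁ hca₁ hU₁ hUi₁⟩
  rw [hfix t ht x]
  rfl

end Iteration

end KatoLp

end Literature.Analysis.FluidPDE

end
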